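import Summits.KontsevichZagierPeriods.KontsevichZagierPeriods.Theses.HermiteRigidity
import Literature.NumberTheory.Transcendental.KZRelationsLE

/-!
# Sketch — crux ideas for `EllipticMomentKernel` (ideator 2, round 1)

Part A (PROVED, sorry-free): the kernel engine over real algebraic scalars of card
`algebraic-scalar-span` — `kernel_of_algebraicSpan`, the module lemmas `scale_add_sub_mem_relations`,
`scale_zero_mem_relations`, `scale_one_eq`, and the torsion-freeness corollary
`mem_relations_of_nsmul_mem` (`n • c ∈ relations → c ∈ relations`).
Part B (statements only, sorried): the move lemmas of both cards (`hermite_recurrence_mem_relations`,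
`moment_descent_mem_relations`, `smoothstep_changeOfVariables`,
`integral_monomial_div_sqrt_cubic_eq_smoothstep`).
-/

set_option linter.dupNamespace false

namespace Summit.KontsevichZagierPeriods.KontsevichZagierPeriods.Cruxes.EllipticMomentKernel.SketchIdeator2

open Literature.NumberTheory.Transcendental MeasureTheory Set

/-- `scale` at propositionally equal scalars (and arbitrary algebraicity proofs) agree. -/
theorem scale_congr {a b : ℝ} (h : a = b) (ha : IsAlgebraic ℚ a) (hb : IsAlgebraic ℚ b) :
    KZ.scale a ha = KZ.scale b hb := by
  subst h; rfl

/-- Generator case of `add_smul`: one integrand-additivity instance. -/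
theorem of_constMul_add_sub_mem_integrandAddRel {n : ℕ} (r : KZ.IntegralRep n) (a b : ℝ)
    (ha : IsAlgebraic ℚ a) (hb : IsAlgebraic ℚ b) :
    KZ.of (r.constMul (a + b) (ha.add hb)) - KZ.of (r.constMul a ha) - KZ.of (r.constMul b hb)
      ∈ KZ.integrandAddRel :=
  ⟨n, r.constMul (a + b) (ha.add hb), r.constMul a ha, r.constMul b hb, rfl, rfl,
    fun x _ => by simp only [KZ.IntegralRep.integrand_constMul, Pi.add_apply]; ring, rfl⟩

/-- Generator case of `zero_smul`: `[σ, 0·f]` is a relation. -/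
theorem of_constMul_zero_mem_relations {n : ℕ} (r : KZ.IntegralRep n) (h0 : IsAlgebraic ℚ (0 : ℝ)) :
    KZ.of (r.constMul 0 h0) ∈ KZ.relations := by
  have h : KZ.of (r.constMul 0 h0) - KZ.of (r.constMul 0 h0) - KZ.of (r.constMul 0 h0)
      ∈ KZ.integrandAddRel :=
    ⟨n, _, _, _, rfl, rfl,
      fun x _ => by simp only [KZ.IntegralRep.integrand_constMul, Pi.add_apply]; ring, rfl⟩
  rw [sub_self, zero_sub] at h
  simpa using KZ.relations.neg_mem (KZ.integrandAddRel_subset_relations h)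

/-- Module axiom `zero_smul` modulo relations. -/
theorem scale_zero_mem_relations (h0 : IsAlgebraic ℚ (0 : ℝ)) (c : KZ.FormalRep) :
    KZ.scale 0 h0 c ∈ KZ.relations := by
  induction c using FreeAbelianGroup.induction_on with
  | zero => simp [KZ.relations.zero_mem]
  | of x =>
      obtain ⟨n, r⟩ := x
      change KZ.scale 0 h0 (KZ.of r) ∈ _
      rw [KZ.scale_of]
      exact of_constMul_zero_mem_relations r h0
  | neg x hx => rw [map_neg]; exact KZ.relations.neg_mem hx
  | add x y hx hy => rw [map_add]; exact KZ.relations.add_mem hx hy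

/-- Module axiom `add_smul` modulo relations. -/
theorem scale_add_sub_mem_relations (a b : ℝ) (ha : IsAlgebraic ℚ a) (hb : IsAlgebraic ℚ b)
    (c : KZ.FormalRep) :
    KZ.scale (a + b) (ha.add hb) c - KZ.scale a ha c - KZ.scale b hb c ∈ KZ.relations := by
  induction c using FreeAbelianGroup.induction_on with
  | zero => simp [KZ.relations.zero_mem]
  | of x =>
      obtain ⟨n, r⟩ := x
      change KZ.scale (a + b) (ha.add hb) (KZ.of r) - KZ.scale a ha (KZ.of r) - KZ.scale b hb (KZ.of r)
        ∈ _
      rw [KZ.scale_of, KZ.scale_of, KZ.scale_of]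
      exact KZ.integrandAddRel_subset_relations
        (of_constMul_add_sub_mem_integrandAddRel r a b ha hb)
  | neg x hx =>
      have e : KZ.scale (a + b) (ha.add hb) (-FreeAbelianGroup.of x) -
            KZ.scale a ha (-FreeAbelianGroup.of x) - KZ.scale b hb (-FreeAbelianGroup.of x)
          = -(KZ.scale (a + b) (ha.add hb) (FreeAbelianGroup.of x) -
              KZ.scale a ha (FreeAbelianGroup.of x) - KZ.scale b hb (FreeAbelianGroup.of x)) := by
        simp only [map_neg]; abel
      rw [e]; exact KZ.relations.neg_mem hx
  | add x y hx hy =>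
      have e : KZ.scale (a + b) (ha.add hb) (x + y) - KZ.scale a ha (x + y) - KZ.scale b hb (x + y)
          = (KZ.scale (a + b) (ha.add hb) x - KZ.scale a ha x - KZ.scale b hb x) +
            (KZ.scale (a + b) (ha.add hb) y - KZ.scale a ha y - KZ.scale b hb y) := by
        simp only [map_add]; abel
      rw [e]; exact KZ.relations.add_mem hx hy

/-- **Kernel-from-span over real algebraic scalars** (first lemma of card algebraic-scalar-span). -/
theorem kernel_of_algebraicSpan {ι : Type*} [Fintype ι]
    (S : Set KZ.FormalRep) (v : ι → KZ.FormalRep)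
    (hspan : ∀ s ∈ S, ∃ (a : ι → ℝ) (ha : ∀ i, IsAlgebraic ℚ (a i)),
      s - ∑ i, KZ.scale (a i) (ha i) (v i) ∈ KZ.relations)
    (hrig : ∀ a : ι → ℝ, (∀ i, IsAlgebraic ℚ (a i)) →
      ∑ i, a i * KZ.eval (v i) = 0 → ∀ i, a i = 0) :
    ∀ c ∈ AddSubgroup.closure S, KZ.eval c = 0 → c ∈ KZ.relations := by
  classical
  have key : ∀ c ∈ AddSubgroup.closure S, ∃ (a : ι → ℝ) (ha : ∀ i, IsAlgebraic ℚ (a i)),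
      c - ∑ i, KZ.scale (a i) (ha i) (v i) ∈ KZ.relations := by
    intro c hc
    induction hc using AddSubgroup.closure_induction with
    | mem x hx => exact hspan x hx
    | zero =>
        refine ⟨fun _ => 0, fun _ => isAlgebraic_zero, ?_⟩
        rw [zero_sub]
        exact KZ.relations.neg_mem (sum_mem fun i _ => scale_zero_mem_relations _ _)
    | add x y hx hy ihx ihy =>
        obtain ⟨a, ha, hxa⟩ := ihx
        obtain ⟨b, hb, hyb⟩ := ihy
        refine ⟨fun i => a i + b i, fun i => (ha i).add (hb i), ?_⟩
        have h3 : ∑ i, (KZ.scale (a i + b i) ((ha i).add (hb i)) (v i) - KZ.scale (a i) (ha i) (v i)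
            - KZ.scale (b i) (hb i) (v i)) ∈ KZ.relations :=
          sum_mem fun i _ => scale_add_sub_mem_relations _ _ _ _ _
        have e : x + y - ∑ i, KZ.scale (a i + b i) ((ha i).add (hb i)) (v i)
            = (x - ∑ i, KZ.scale (a i) (ha i) (v i)) + (y - ∑ i, KZ.scale (b i) (hb i) (v i))
              - ∑ i, (KZ.scale (a i + b i) ((ha i).add (hb i)) (v i) - KZ.scale (a i) (ha i) (v i)
                - KZ.scale (b i) (hb i) (v i)) := by
          simp only [Finset.sum_sub_distrib]; abel
        rw [e]
        exact KZ.relations.sub_mem (KZ.relations.add_mem hxa hyb) h3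
    | neg x hx ihx =>
        obtain ⟨a, ha, hxa⟩ := ihx
        refine ⟨fun i => -a i, fun i => (ha i).neg, ?_⟩
        have h3 : ∀ i, KZ.scale (a i) (ha i) (v i) + KZ.scale (-a i) (ha i).neg (v i)
            ∈ KZ.relations := by
          intro i
          have h1 := scale_add_sub_mem_relations (a i) (-a i) (ha i) (ha i).neg (v i)
          have h2 : KZ.scale (a i + -a i) ((ha i).add (ha i).neg) (v i) ∈ KZ.relations := by
            rw [scale_congr (add_neg_cancel (a i)) ((ha i).add (ha i).neg) isAlgebraic_zero]
            exact scale_zero_mem_relations _ _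
          have e : KZ.scale (a i) (ha i) (v i) + KZ.scale (-a i) (ha i).neg (v i)
              = KZ.scale (a i + -a i) ((ha i).add (ha i).neg) (v i)
                - (KZ.scale (a i + -a i) ((ha i).add (ha i).neg) (v i) - KZ.scale (a i) (ha i) (v i)
                  - KZ.scale (-a i) (ha i).neg (v i)) := by abel
          rw [e]; exact KZ.relations.sub_mem h2 h1
        have e : -x - ∑ i, KZ.scale (-a i) (ha i).neg (v i)
            = -(x - ∑ i, KZ.scale (a i) (ha i) (v i))
              - ∑ i, (KZ.scale (a i) (ha i) (v i) + KZ.scale (-a i) (ha i).neg (v i)) := by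
          simp only [Finset.sum_add_distrib]; abel
        rw [e]
        exact KZ.relations.sub_mem (KZ.relations.neg_mem hxa) (sum_mem fun i _ => h3 i)
  intro c hc hc0
  obtain ⟨a, ha, hca⟩ := key c hc
  have hsound : KZ.eval (c - ∑ i, KZ.scale (a i) (ha i) (v i)) = 0 :=
    (AddMonoidHom.mem_ker).1 (KZ.relations_le_ker_eval_holds hca)
  rw [map_sub, hc0, map_sum, zero_sub, neg_eq_zero] at hsound
  simp only [KZ.eval_scale] at hsound
  have ha0 : ∀ i, a i = 0 := hrig a ha hsound
  have hsum : ∑ i, KZ.scale (a i) (ha i) (v i) ∈ KZ.relations := by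
    refine sum_mem fun i _ => ?_
    rw [scale_congr (ha0 i) (ha i) isAlgebraic_zero]
    exact scale_zero_mem_relations _ _
  have e : c = (c - ∑ i, KZ.scale (a i) (ha i) (v i)) + ∑ i, KZ.scale (a i) (ha i) (v i) := by
    abel
  rw [e]
  exact KZ.relations.add_mem hca hsum

/-- Module axiom `one_smul`, on the nose. -/
theorem scale_one_eq (c : KZ.FormalRep) : KZ.scale 1 isAlgebraic_one c = c := by
  induction c using FreeAbelianGroup.induction_on with
  | zero => simp
  | of x =>
      obtain ⟨m, r⟩ := x
      change KZ.scale 1 isAlgebraic_one (KZ.of r) = KZ.of r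
      rw [KZ.scale_of]
      congr 1
      cases r
      simp [KZ.IntegralRep.constMul]
  | neg x hx => rw [map_neg, hx]
  | add x y hx hy => rw [map_add, hx, hy]

/-- Corollary: the route's support item `RigidKernel`-shape statement for a FINITE rigid family is
an instance (sanity of the engine's interface): torsion-freeness of the formal period group,
`n • c ∈ relations → c ∈ relations` for `n ≠ 0`, in the special case used by reductions. -/
theorem mem_relations_of_nsmul_mem {c : KZ.FormalRep} {n : ℕ} (hn : n ≠ 0)
    (h : n • c ∈ KZ.relations) : c ∈ KZ.relations := by
  -- c ≡ n • scale (1/n) c and scale (1/n) (n • c) ∈ relations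
  have hq : IsAlgebraic ℚ ((n : ℝ)⁻¹) := (isAlgebraic_nat n).inv
  have h1 : KZ.scale ((n : ℝ)⁻¹) hq (n • c) ∈ KZ.relations := KZ.scale_mem_relations _ _ h
  rw [map_nsmul] at h1
  -- c - n • scale (1/n) c ∈ relations, generator-wise from add_smul
  have h2 : ∀ k : ℕ, KZ.scale ((k : ℝ) * (n : ℝ)⁻¹) ((isAlgebraic_nat k).mul hq) c
      - k • KZ.scale ((n : ℝ)⁻¹) hq c ∈ KZ.relations := by
    intro k
    induction k with
    | zero =>
        rw [zero_nsmul, sub_zero, scale_congr (by simp : ((0 : ℕ) : ℝ) * (n : ℝ)⁻¹ = 0) _ isAlgebraic_zero]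
        exact scale_zero_mem_relations _ _
    | succ k ih =>
        have hstep := scale_add_sub_mem_relations ((k : ℝ) * (n : ℝ)⁻¹) ((n : ℝ)⁻¹)
          ((isAlgebraic_nat k).mul hq) hq c
        have ek : ((k : ℝ) * (n : ℝ)⁻¹ + (n : ℝ)⁻¹) = (((k + 1 : ℕ) : ℝ) * (n : ℝ)⁻¹) := by
          push_cast; ring
        rw [scale_congr ek _ ((isAlgebraic_nat (k + 1)).mul hq)] at hstep
        have e : KZ.scale (((k + 1 : ℕ) : ℝ) * (n : ℝ)⁻¹) ((isAlgebraic_nat (k + 1)).mul hq) c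
            - (k + 1) • KZ.scale ((n : ℝ)⁻¹) hq c
            = (KZ.scale (((k + 1 : ℕ) : ℝ) * (n : ℝ)⁻¹) ((isAlgebraic_nat (k + 1)).mul hq) c
                - KZ.scale ((k : ℝ) * (n : ℝ)⁻¹) ((isAlgebraic_nat k).mul hq) c
                - KZ.scale ((n : ℝ)⁻¹) hq c)
              + (KZ.scale ((k : ℝ) * (n : ℝ)⁻¹) ((isAlgebraic_nat k).mul hq) c
                - k • KZ.scale ((n : ℝ)⁻¹) hq c) := by
          rw [succ_nsmul]; abel
        rw [e]
        exact KZ.relations.add_mem hstep ih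
  have h3 := h2 n
  have en : (n : ℝ) * (n : ℝ)⁻¹ = 1 := mul_inv_cancel₀ (Nat.cast_ne_zero.mpr hn)
  rw [scale_congr en _ isAlgebraic_one] at h3
  rw [scale_one_eq] at h3
  have e : c = (c - n • KZ.scale ((n : ℝ)⁻¹) hq c) + n • KZ.scale ((n : ℝ)⁻¹) hq c := by abel
  rw [e]
  exact KZ.relations.add_mem h3 h1

/-! ## Part B — move lemmas (statements only) -/

/-- The ONE move family of the reduction half (Hermite recurrence with `P = x^d`):
`T(x^d) = (4d+6) x^{d+2} − (d + 1/2) q₂ x^d − d q₃ x^{d−1}` and `[σ, T(P)/√f] ∈ relations`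
(support item `HermiteExactFormVanishes` specialised to monomial `P`). In the vector space
`FormalRep ⧸ relations` it solves the class of `[σ, x^{d+2}/√f]` in terms of lower degrees, so by
strong induction every second-kind class lies in the span of `[σ, 1/√f]`, `[σ, x/√f]`. -/
theorem hermite_recurrence_mem_relations (q₂ q₃ : ℚ)
    (hΔ : 0 < (q₂ : ℝ) ^ 3 - 27 * (q₃ : ℝ) ^ 2) (d : ℕ) :
    let f : ℝ → ℝ := fun x => 4 * x ^ 3 - (q₂ : ℝ) * x - (q₃ : ℝ)
    let σ : Set (Fin 1 → ℝ) := {p | 0 < f (p 0) ∧ ∃ t : ℝ, p 0 < t ∧ f t < 0}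
    ∀ r : KZ.IntegralRep 1, r.domain = σ →
      Set.EqOn r.integrand (fun p => ((4 * (d : ℝ) + 6) * (p 0) ^ (d + 2)
        - ((d : ℝ) + 1 / 2) * (q₂ : ℝ) * (p 0) ^ d
        - (d : ℝ) * (q₃ : ℝ) * (p 0) ^ (d - 1)) / Real.sqrt (f (p 0))) σ →
      KZ.of r ∈ KZ.relations := by
  sorry

/-- Descent of a moment (one Newton–Leibniz move along `y`, polynomial primitive
`x^a y^{b+1}/(b+1)`, plus a null modification of the band): the class of `[D, x^a y^b]` is the
class of `[σ, x^a f^{(b+1)/2}/(b+1)]`. -/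
theorem moment_descent_mem_relations (q₂ q₃ : ℚ)
    (hΔ : 0 < (q₂ : ℝ) ^ 3 - 27 * (q₃ : ℝ) ^ 2) (a b : ℕ) :
    let f : ℝ → ℝ := fun x => 4 * x ^ 3 - (q₂ : ℝ) * x - (q₃ : ℝ)
    let σ : Set (Fin 1 → ℝ) := {p | 0 < f (p 0) ∧ ∃ t : ℝ, p 0 < t ∧ f t < 0}
    let D : Set (Fin 2 → ℝ) :=
      {p | (0 < f (p 0) ∧ ∃ t : ℝ, p 0 < t ∧ f t < 0) ∧ 0 < p 1 ∧ p 1 ^ 2 < f (p 0)}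
    ∀ (r : KZ.IntegralRep 2) (r' : KZ.IntegralRep 1), r.domain = D →
      Set.EqOn r.integrand (fun p => p 0 ^ a * p 1 ^ b) D → r'.domain = σ →
      Set.EqOn r'.integrand
        (fun p => p 0 ^ a * Real.sqrt (f (p 0)) ^ (b + 1) / ((b : ℝ) + 1)) σ →
      KZ.of r - KZ.of r' ∈ KZ.relations := by
  sorry

/-! ## Card `smoothstep-desingularisation` -/

/-- FIRST LEMMA (card smoothstep-desingularisation): the Korobov/smoothstep reparametrisation
`x(s) = e₃ + (e₂ − e₃) s² (3 − 2s)` of the bounded oval is ONE change-of-variables move carrying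
every second-kind representation `[σ, g(x)/√f(x)]` to a representation on `(0,1)` with the
bounded integrand `3 g(x(s)) / √((3 − 2s)(1 + 2s)(e₁ − x(s)))` (since
`√f(x(s)) = 2 (e₂−e₃) s (1−s) √((3−2s)(1+2s)(e₁−x(s)))` and `x'(s) = 6 (e₂−e₃) s (1−s)`). -/
theorem smoothstep_changeOfVariables (q₂ q₃ : ℚ) (e₁ e₂ e₃ : ℝ) (he : e₃ < e₂ ∧ e₂ < e₁)
    (hf : ∀ x : ℝ, 4 * x ^ 3 - (q₂ : ℝ) * x - (q₃ : ℝ) = 4 * (x - e₁) * (x - e₂) * (x - e₃))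
    (g : ℝ → ℝ) (hg : IsSemialgebraicFunOn ℚ (Set.univ : Set (Fin 1 → ℝ)) fun p => g (p 0)) :
    let f : ℝ → ℝ := fun x => 4 * x ^ 3 - (q₂ : ℝ) * x - (q₃ : ℝ)
    let σ : Set (Fin 1 → ℝ) := {p | 0 < f (p 0) ∧ ∃ t : ℝ, p 0 < t ∧ f t < 0}
    let xs : ℝ → ℝ := fun s => e₃ + (e₂ - e₃) * s ^ 2 * (3 - 2 * s)
    ∀ (r r' : KZ.IntegralRep 1), r'.domain = σ →
      Set.EqOn r'.integrand (fun p => g (p 0) / Real.sqrt (f (p 0))) σ →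
      r.domain = {p | 0 < p 0 ∧ p 0 < 1} →
      Set.EqOn r.integrand (fun p => 3 * g (xs (p 0)) /
        Real.sqrt ((3 - 2 * p 0) * (1 + 2 * p 0) * (e₁ - xs (p 0)))) {p | 0 < p 0 ∧ p 0 < 1} →
      KZ.of r - KZ.of r' ∈ KZ.changeOfVariablesRel := by
  sorry

/-- The value identity and the free integrability for the hypothesis integrals `J₀, J₁`
(Mathlib `integral_image_eq_integral_abs_deriv_smul` /
`integrableOn_image_iff_integrableOn_abs_deriv_smul`, no integrability hypothesis): the singular
integrals over `(e₃, e₂)` equal integrals of continuous functions over `(0, 1)`. -/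
theorem integral_monomial_div_sqrt_cubic_eq_smoothstep (e₁ e₂ e₃ : ℝ) (he : e₃ < e₂ ∧ e₂ < e₁)
    (m : ℕ) :
    let xs : ℝ → ℝ := fun s => e₃ + (e₂ - e₃) * s ^ 2 * (3 - 2 * s)
    (∫ x in Set.Ioo e₃ e₂, x ^ m / Real.sqrt (4 * (x - e₁) * (x - e₂) * (x - e₃))) =
      ∫ s in Set.Ioo (0 : ℝ) 1, 3 * xs s ^ m /
        Real.sqrt ((3 - 2 * s) * (1 + 2 * s) * (e₁ - xs s)) ∧
    IntegrableOn (fun x => x ^ m / Real.sqrt (4 * (x - e₁) * (x - e₂) * (x - e₃)))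
      (Set.Ioo e₃ e₂) := by
  sorry

end Summit.KontsevichZagierPeriods.KontsevichZagierPeriods.Cruxes.EllipticMomentKernel.SketchIdeator2
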